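import Summits.NavierStokesRegularity.NavierStokesRegularity.Theorems.SoloSalvageWu2026ConstructExteriorTools
import Summits.NavierStokesRegularity.NavierStokesRegularity.Theorems.SoloSalvageWu2026ConstructWeights
import Summits.NavierStokesRegularity.NavierStokesRegularity.Theorems.SoloSalvageWu2026ConstructLimitTools
import Summits.NavierStokesRegularity.NavierStokesRegularity.Theorems.SoloSalvageWu2026ConstructCompactV
import Mathlib.MeasureTheory.Integral.Bochner.ContinuousLinearMap
import HarnessLib

/-!
# C177 `Wu2026` — sub-binder (E) of `Step_construct`, core: the weak gradient of the blow-down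
# limit on `{|y| > 1}` from a uniform local `L^{9/5}` gradient bound (cell `pub/ns-inputs`, seat
# `ns-in-wu-con`; route business of `GaldiLiouvilleGate`, item stmt-NavierStokesRegularity-0897)

The analytic core of piece (E) ((3.35) p.13 l.6–83: «V_j is bounded in W^{1,9/5} on compact subsets
of {|y| > 1} … the limit V ∈ W^{1,9/5}_loc({|y| > 1})»): given the uniform bound
`sup_j ∫_B |∇V_j|^{9/5} < ∞` on every admissible ball `B = B(c, r)`, `1 + r < |c|` (hypothesis
`hG2` below; in print from (3.32)–(3.34) by the local div–curl estimate), and the `L⁴_loc`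
convergence `V_j → V`, there are scalar functions `g_{k,i}` — the weak partial derivatives
`∂_k V_i` — with `|g_{k,i}|^{9/5}` integrable on every compact `K ⊆ {|y| > 1}` and
`∫ ∂_kφ ⟪V, e_i⟫ = −∫ φ g_{k,i}` for `φ ∈ C_c^∞({|y| > 1})`. Route: weak sequential compactness in
`L^{9/5}(w dy)` for the summable weight `w` of `…ConstructWeights` (ONE subsequence for the whole
exterior region: `exists_common_subseq_weakLp` over the nine components), integration by parts at
level `j` (`integral_fderiv_apply_eq_zero`), and the strong `L¹_loc` convergence of `V_j`.

Theorems only, standard axioms, no `sorry`.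

WHAT THIS IS NOT: not a proof of `Step_construct`; not a claim about NS regularity or blow-up; not
a claim about any author beyond the typed locator.
-/

set_option linter.dupNamespace false

noncomputable section

open MeasureTheory Set Filter Topology Module Metric TopologicalSpace
open scoped ENNReal NNReal Topology RealInnerProductSpace Pointwise

namespace Summit.NavierStokesRegularity.NavierStokesRegularity.Theorems.Wu2026Salvage

open Literature.Analysis.FluidPDE Literature.Analysis.FunctionSpaces Literature.Claims.NS.Wu2026

/-- Integration by parts for one component: for `U ∈ C¹` and `φ ∈ C¹_c`,
`∫ ∂_aφ ⟪U, b⟫ = −∫ φ ⟪DU·a, b⟫`. [cite: Wu2026, (3.35) p.13 (weak derivatives)] -/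
theorem integral_fderiv_mul_inner_eq {U : E3 → E3} (hU : ContDiff ℝ 1 U) {φ : E3 → ℝ}
    (hφ : ContDiff ℝ 1 φ) (hφc : HasCompactSupport φ) (a b : E3) :
    ∫ y, fderiv ℝ φ y a * ⟪U y, b⟫ = -∫ y, φ y * ⟪fderiv ℝ U y a, b⟫ := by
  have hUd : ∀ y, DifferentiableAt ℝ U y := fun y => hU.differentiable one_ne_zero y
  have hφd : ∀ y, DifferentiableAt ℝ φ y := fun y => hφ.differentiable one_ne_zero y
  have hib : ContDiff ℝ 1 fun y => ⟪U y, b⟫ := hU.inner ℝ contDiff_const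
  have hh : ContDiff ℝ 1 fun y => φ y * ⟪U y, b⟫ := hφ.mul hib
  have hhc : HasCompactSupport fun y => φ y * ⟪U y, b⟫ := hφc.mul_right
  have h0 := integral_fderiv_apply_eq_zero hh hhc a
  have hder : ∀ y, fderiv ℝ (fun y => φ y * ⟪U y, b⟫) y a =
      fderiv ℝ φ y a * ⟪U y, b⟫ + φ y * ⟪fderiv ℝ U y a, b⟫ := by
    intro y
    rw [fderiv_fun_mul (hφd y) (hib.differentiable one_ne_zero y)]
    simp only [FunLike.coe_add, Pi.add_apply, FunLike.coe_smul, Pi.smul_apply, smul_eq_mul]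
    rw [fderiv_inner_apply ℝ (hUd y) (differentiableAt_const b)]
    simp only [fderiv_fun_const, Pi.zero_apply, FunLike.coe_zero, inner_zero_right, zero_add]
    ring
  simp_rw [hder] at h0
  have hDφc : HasCompactSupport (fderiv ℝ φ) := hφc.fderiv (𝕜 := ℝ)
  have i1 : Integrable (fun y => fderiv ℝ φ y a * ⟪U y, b⟫) := by
    refine (((hφ.continuous_fderiv one_ne_zero).clm_apply continuous_const).mul
      (hU.continuous.inner continuous_const)).integrable_of_hasCompactSupport ?_
    exact (hDφc.mono fun x hx => by
      contrapose! hx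
      simp only [Function.mem_support, ne_eq, not_not] at hx ⊢
      simp [hx]).mul_right
  have i2 : Integrable (fun y => φ y * ⟪fderiv ℝ U y a, b⟫) :=
    (hφ.continuous.mul (((hU.continuous_fderiv one_ne_zero).clm_apply continuous_const).inner
      continuous_const)).integrable_of_hasCompactSupport hφc.mul_right
  rw [integral_add i1 i2] at h0
  linarith

/-- **Weak partial derivatives of the blow-down limit on `{|y| > 1}`** from the uniform local
`L^{9/5}` gradient bound at good scales (the core of (3.35), p.13): scalar weak derivatives
`g_{k,i} = ∂_k V_i ∈ L^{9/5}_loc({|y| > 1})`. [cite: Wu2026, (3.32)–(3.35) p.13 l.6–83] -/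
theorem exists_weakGradient_of_localGradBound
    (hG2 : ∀ ν : ℝ, 0 < ν → ∀ (v : E3 → E3) (p : E3 → ℝ), IsWuFlow ν v p →
      MemWeakLp v ((9 : ℝ≥0∞) / 2) volume →
      (∀ q : ℝ, 1 < q → q < 9 / 2 → ∃ C : ℝ, ∀ R : ℝ, 0 < R →
        IntegrableOn (fun x => ‖v x‖ ^ q) (annulus R) ∧
        (∫ x in annulus R, ‖v x‖ ^ q) ^ (1 / q) ≤ C * R ^ (-(2 : ℝ) / 3 + 3 / q)) →
      ∀ n : ℕ → ℕ, Tendsto n atTop atTop →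
        (∀ m : ℕ, ∃ B : ℝ, ∀ j : ℕ, max 1 m ≤ j → dyMass v (n j + m) ≤ B) →
      ∀ c : E3, ∀ r : ℝ, 0 < r → 1 + r < ‖c‖ → ∃ C : ℝ, ∀ j : ℕ,
        ∫ y in ball c r, ‖fderiv ℝ (blowDown ((2 : ℝ) ^ n j) v) y‖ ^ ((9 : ℝ) / 5) ≤ C)
    {ν : ℝ} (hν : 0 < ν) {v : E3 → E3} {p : E3 → ℝ} (hflow : IsWuFlow ν v p)
    (hweak : MemWeakLp v ((9 : ℝ≥0∞) / 2) volume)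
    (h318 : ∀ q : ℝ, 1 < q → q < 9 / 2 → ∃ C : ℝ, ∀ R : ℝ, 0 < R →
        IntegrableOn (fun x => ‖v x‖ ^ q) (annulus R) ∧
        (∫ x in annulus R, ‖v x‖ ^ q) ^ (1 / q) ≤ C * R ^ (-(2 : ℝ) / 3 + 3 / q))
    {n : ℕ → ℕ} (hn : Tendsto n atTop atTop)
    (hgood : ∀ m : ℕ, ∃ B : ℝ, ∀ j : ℕ, max 1 m ≤ j → dyMass v (n j + m) ≤ B)
    {V : E3 → E3} (hVm : AEStronglyMeasurable V volume)
    (hVint : ∀ K : Set E3, IsCompact K → K ⊆ punctured → IntegrableOn (fun y => ‖V y‖ ^ (4 : ℝ)) K)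
    (hconvV : ∀ K : Set E3, IsCompact K → K ⊆ punctured →
      Tendsto (fun j => ∫ y in K, ‖blowDown ((2 : ℝ) ^ n j) v y - V y‖ ^ (4 : ℝ)) atTop (𝓝 0)) :
    ∃ g : Fin 3 × Fin 3 → E3 → ℝ,
      (∀ ki, AEStronglyMeasurable (g ki) volume) ∧
      (∀ K : Set E3, IsCompact K → K ⊆ exterior → ∀ ki,
        IntegrableOn (fun y => |g ki y| ^ ((9 : ℝ) / 5)) K) ∧
      ∀ φ : E3 → ℝ, IsTest exterior φ → ∀ k i : Fin 3,
        ∫ y, fderiv ℝ φ y (EuclideanSpace.single k 1) * ⟪V y, EuclideanSpace.single i 1⟫ =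
          -∫ y, φ y * g (k, i) y := by
  classical
  -- the rescaled fields
  set Vj : ℕ → E3 → E3 := fun j => blowDown ((2 : ℝ) ^ n j) v with hVj_def
  have hVs : ∀ j, ContDiff ℝ (⊤ : ℕ∞) (Vj j) := fun j => contDiff_blowDown hflow.smooth_v _
  have hV1 : ∀ j, ContDiff ℝ 1 (Vj j) := fun j => (hVs j).of_le (by norm_cast)
  have hVc : ∀ j, Continuous (Vj j) := fun j => (hVs j).continuous
  have hDVc : ∀ j, Continuous (fderiv ℝ (Vj j)) := fun j => (hV1 j).continuous_fderiv one_ne_zero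
  have hVjm : ∀ j, AEStronglyMeasurable (Vj j) volume := fun j => (hVc j).aestronglyMeasurable
  set e : Fin 3 → E3 := fun k => EuclideanSpace.single k 1 with he_def
  have he1 : ∀ k, ‖e k‖ = 1 := fun k => by
    refine (PiLp.norm_single 2 (fun _ : Fin 3 => ℝ) k (1 : ℝ)).trans ?_; simp
  -- admissible balls covering the exterior region, with their gradient bounds
  obtain ⟨c, hc1, hcover⟩ := exists_centres_cover_exterior
  set r : ℕ → ℝ := fun k => (‖c k‖ - 1) / 3 with hr_def
  have hr : ∀ k, 0 < r k := fun k => by have := hc1 k; simp only [hr_def]; linarith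
  have hcr : ∀ k, 1 + r k < ‖c k‖ := fun k => by have := hc1 k; simp only [hr_def]; linarith
  set B : ℕ → Set E3 := fun k => ball (c k) (r k) with hB_def
  have hBmeas : ∀ k, MeasurableSet (B k) := fun k => measurableSet_ball
  have hBfin : ∀ k, volume (B k) ≠ ∞ := fun k => measure_ball_lt_top.ne
  have hBext : ∀ k, B k ⊆ exterior := fun k =>
    ball_subset_closedBall.trans (closedBall_subset_exterior_of_one_lt (hc1 k))
  have hgrad : ∀ k, ∃ C : ℝ, ∀ j, ∫ y in B k, ‖fderiv ℝ (Vj j) y‖ ^ ((9 : ℝ) / 5) ≤ C := fun k =>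
    hG2 ν hν v p hflow hweak h318 n hn hgood (c k) (r k) (hr k) (hcr k)
  choose Cg hCg using hgrad
  -- the weight and the finite measure `μ = w dy`
  obtain ⟨w, ε, hwm, hw1, hε0, hε1, hεw, hwint, hwg⟩ := exists_summable_weight B hBmeas hBfin Cg
  have hwlt : ∀ y, w y < ∞ := fun y => (hw1 y).trans_lt ENNReal.one_lt_top
  have hεtop : ∀ k, ε k ≠ ∞ := fun k => ((hε1 k).trans_lt ENNReal.one_lt_top).ne
  set μ : Measure E3 := volume.withDensity w with hμ_def
  haveI hμfin : IsFiniteMeasure μ := by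
    refine ⟨?_⟩
    rw [hμ_def, withDensity_apply _ MeasurableSet.univ, Measure.restrict_univ]
    exact hwint.trans_lt ENNReal.one_lt_top
  -- the nine component sequences
  set F : Fin 3 × Fin 3 → ℕ → E3 → ℝ := fun ki j y => ⟪fderiv ℝ (Vj j) y (e ki.1), e ki.2⟫
    with hF_def
  have hFc : ∀ ki j, Continuous (F ki j) := fun ki j =>
    ((hDVc j).clm_apply continuous_const).inner continuous_const
  have hFm : ∀ ki j, Measurable (F ki j) := fun ki j => (hFc ki j).measurable
  have hFle : ∀ ki j y, ‖F ki j y‖ₑ ≤ ‖fderiv ℝ (Vj j) y‖ₑ := by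
    intro ki j y
    rw [← ofReal_norm, ← ofReal_norm]
    refine ENNReal.ofReal_le_ofReal ?_
    calc ‖F ki j y‖ = |⟪fderiv ℝ (Vj j) y (e ki.1), e ki.2⟫| := Real.norm_eq_abs _
      _ ≤ ‖fderiv ℝ (Vj j) y (e ki.1)‖ * ‖e ki.2‖ := abs_real_inner_le_norm _ _
      _ ≤ ‖fderiv ℝ (Vj j) y‖ * ‖e ki.1‖ * ‖e ki.2‖ := by
          gcongr; exact ContinuousLinearMap.le_opNorm _ _
      _ = ‖fderiv ℝ (Vj j) y‖ := by rw [he1, he1, mul_one, mul_one]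
  -- uniform `L^{9/5}(μ)` bound
  have hFbd : ∀ ki j, ∫⁻ y, ‖F ki j y‖ₑ ^ ((9 : ℝ) / 5) ∂μ ≤ 1 := by
    intro ki j
    rw [hμ_def, lintegral_withDensity_eq_lintegral_mul₀ hwm.aemeasurable
      ((hFm ki j).enorm.pow_const _).aemeasurable]
    refine hwg _ ((hFm ki j).enorm.pow_const _) fun k => ?_
    calc ∫⁻ y in B k, ‖F ki j y‖ₑ ^ ((9 : ℝ) / 5)
        ≤ ∫⁻ y in B k, ‖fderiv ℝ (Vj j) y‖ₑ ^ ((9 : ℝ) / 5) :=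
          lintegral_mono fun y => ENNReal.rpow_le_rpow (hFle ki j y) (by norm_num)
      _ = ∫⁻ y in B k, ENNReal.ofReal (‖fderiv ℝ (Vj j) y‖ ^ ((9 : ℝ) / 5)) :=
          lintegral_congr fun y => (ofReal_norm_rpow _ (by norm_num)).symm
      _ = ENNReal.ofReal (∫ y in B k, ‖fderiv ℝ (Vj j) y‖ ^ ((9 : ℝ) / 5)) := by
          refine (ofReal_integral_eq_lintegral_ofReal ?_
            (Eventually.of_forall fun y => Real.rpow_nonneg (norm_nonneg _) _)).symm
          exact integrableOn_ball_of_continuous ((hDVc j).norm.rpow_const fun _ => Or.inr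
            (by norm_num)) _ _
      _ ≤ ENNReal.ofReal (Cg k) := ENNReal.ofReal_le_ofReal (hCg k j)
  -- ONE weakly convergent subsequence for all nine components
  have hpq : (9 / 5 : ℝ).HolderConjugate (9 / 4) := ⟨by norm_num, by norm_num, by norm_num⟩
  obtain ⟨σ, hσ, hS⟩ := exists_common_subseq_weakLp (Finset.univ : Finset (Fin 3 × Fin 3)) hpq F
    (fun ki j => (hFc ki j).aestronglyMeasurable) ENNReal.one_ne_top
    (fun ki j => by simpa using hFbd ki j)
  have hS' : ∀ ki : Fin 3 × Fin 3, ∃ g : E3 → ℝ, MemLp g (ENNReal.ofReal (9 / 5)) μ ∧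
      ∫⁻ x, ‖g x‖ₑ ^ (9 / 5 : ℝ) ∂μ ≤ 1 ∧ ∀ ψ : E3 → ℝ, MemLp ψ (ENNReal.ofReal (9 / 4)) μ →
        Tendsto (fun j => ∫ x, F ki (σ j) x * ψ x ∂μ) atTop (𝓝 (∫ x, g x * ψ x ∂μ)) :=
    fun ki => hS ki (Finset.mem_univ ki)
  choose g hgmem hgbd hgw using hS'
  -- measurability of `g` w.r.t. `volume`: `μ` and `volume` agree up to the positive density `w`
  -- on the exterior; we use the representative given by `MemLp` (a.e.-strongly measurable for
  -- `μ`), which is a.e.-strongly measurable for `volume` on every ball `B k`.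
  have hgm_ball : ∀ ki k, AEStronglyMeasurable (g ki) (volume.restrict (B k)) := by
    intro ki k
    have h1 : AEStronglyMeasurable (g ki) μ := (hgmem ki).1
    -- `volume.restrict (B k) ≪ μ` since `w ≥ ε k > 0` on `B k`
    have hac : volume.restrict (B k) ≪ μ := by
      refine Measure.AbsolutelyContinuous.mk fun s hs hμs => ?_
      rw [hμ_def, withDensity_apply _ hs] at hμs
      rw [Measure.restrict_apply hs]
      have hle : ε k * volume (s ∩ B k) ≤ ∫⁻ y in s, w y := by
        calc ε k * volume (s ∩ B k) = ∫⁻ y in s ∩ B k, ε k := by rw [setLIntegral_const]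
          _ ≤ ∫⁻ y in s ∩ B k, w y :=
              setLIntegral_mono' (hs.inter (hBmeas k)) fun y hy => hεw k y hy.2
          _ ≤ ∫⁻ y in s, w y := lintegral_mono_set inter_subset_left
      rw [hμs] at hle
      have := le_antisymm hle bot_le
      rcases mul_eq_zero.1 this with h | h
      · exact absurd h (hε0 k)
      · exact h
    exact h1.mono_ac hac
  -- local `L^{9/5}` bounds of `g` w.r.t. `volume`: `ε_k ∫_{B_k} |g|^{9/5} ≤ ∫ w |g|^{9/5} ≤ 1`
  have hg_ball : ∀ ki k, ∫⁻ y in B k, ‖g ki y‖ₑ ^ ((9 : ℝ) / 5) ≤ (ε k)⁻¹ := by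
    intro ki k
    have hGμ : AEMeasurable (fun y => ‖g ki y‖ₑ ^ ((9 : ℝ) / 5)) μ :=
      (hgmem ki).1.enorm.pow_const _
    have key : ∫⁻ y, w y * ‖g ki y‖ₑ ^ ((9 : ℝ) / 5) = ∫⁻ y, ‖g ki y‖ₑ ^ ((9 : ℝ) / 5) ∂μ := by
      rw [hμ_def, lintegral_withDensity_eq_lintegral_mul₀' hwm.aemeasurable (by exact hGμ)]
      rfl
    have hmul : ε k * ∫⁻ y in B k, ‖g ki y‖ₑ ^ ((9 : ℝ) / 5) ≤ 1 := by
      calc ε k * ∫⁻ y in B k, ‖g ki y‖ₑ ^ ((9 : ℝ) / 5)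
          = ∫⁻ y in B k, ε k * ‖g ki y‖ₑ ^ ((9 : ℝ) / 5) := (lintegral_const_mul' _ _ (hεtop k)).symm
        _ ≤ ∫⁻ y in B k, w y * ‖g ki y‖ₑ ^ ((9 : ℝ) / 5) :=
            setLIntegral_mono' (hBmeas k) fun y hy => mul_le_mul' (hεw k y hy) le_rfl
        _ ≤ ∫⁻ y, w y * ‖g ki y‖ₑ ^ ((9 : ℝ) / 5) := lintegral_mono' Measure.restrict_le_self le_rfl
        _ = ∫⁻ y, ‖g ki y‖ₑ ^ ((9 : ℝ) / 5) ∂μ := key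
        _ ≤ 1 := by simpa using hgbd ki
    rw [mul_comm] at hmul
    exact ENNReal.le_inv_iff_mul_le.2 hmul
  -- the exterior region is exactly the union of the balls
  set U : Set E3 := ⋃ k, B k with hU_def
  have hUext : U = exterior := by
    apply Subset.antisymm (iUnion_subset hBext)
    intro y hy
    obtain ⟨k, hk⟩ := hcover y hy
    exact mem_iUnion.2 ⟨k, hk⟩
  have hUmeas : MeasurableSet U := MeasurableSet.iUnion hBmeas
  -- the output: `g` cut off to the exterior region (measurable for `volume`)
  set gout : Fin 3 × Fin 3 → E3 → ℝ := fun ki => U.indicator (g ki) with hgout_def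
  have hgout_m : ∀ ki, AEStronglyMeasurable (gout ki) volume := fun ki =>
    (aestronglyMeasurable_indicator_iff hUmeas).2 (aestronglyMeasurable_iUnion_iff.2 (hgm_ball ki))
  have hgout_eq : ∀ ki k, EqOn (gout ki) (g ki) (B k) := fun ki k y hy =>
    indicator_of_mem (mem_iUnion.2 ⟨k, hy⟩) _
  refine ⟨gout, hgout_m, fun K hK hKext ki => ?_, fun φ hφ k i => ?_⟩
  ----------------------------------------------------------------
  -- local integrability of `|g|^{9/5}` on compact subsets of the exterior region
  ----------------------------------------------------------------
  · have hcov : K ⊆ ⋃ k, B k := fun y hy => by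
      obtain ⟨k, hk⟩ := hcover y (hKext hy); exact mem_iUnion.2 ⟨k, hk⟩
    obtain ⟨t, ht⟩ := hK.elim_finite_subcover B (fun k => isOpen_ball) hcov
    have hball : ∀ k, IntegrableOn (fun y => |gout ki y| ^ ((9 : ℝ) / 5)) (B k) volume := by
      intro k
      have hgk : IntegrableOn (fun y => |g ki y| ^ ((9 : ℝ) / 5)) (B k) volume := by
        have hm : AEStronglyMeasurable (fun y => |g ki y| ^ ((9 : ℝ) / 5)) (volume.restrict (B k)) := by
          have := ((hgm_ball ki k).norm.aemeasurable.pow_const ((9 : ℝ) / 5)).aestronglyMeasurable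
          simpa only [Real.norm_eq_abs] using this
        refine ⟨hm, ?_⟩
        · rw [hasFiniteIntegral_iff_enorm]
          have heq : ∫⁻ y in B k, ‖|g ki y| ^ ((9 : ℝ) / 5)‖ₑ = ∫⁻ y in B k, ‖g ki y‖ₑ ^ ((9 : ℝ) / 5) :=
            lintegral_congr fun y => by
              rw [Real.enorm_eq_ofReal (Real.rpow_nonneg (abs_nonneg _) _), ← Real.norm_eq_abs,
                ofReal_norm_rpow _ (by norm_num)]
          rw [heq]
          exact (hg_ball ki k).trans_lt (ENNReal.inv_lt_top.2 (pos_iff_ne_zero.2 (hε0 k)))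
      exact hgk.congr_fun (fun y hy => by simp only [hgout_eq ki k hy]) (hBmeas k)
    exact (integrableOn_finset_iUnion.2 fun k _ => hball k).mono_set ht
  ----------------------------------------------------------------
  -- the weak-derivative identity
  ----------------------------------------------------------------
  · obtain ⟨hφs, hφc, hφp⟩ := hφ
    set K : Set E3 := tsupport φ with hK_def
    have hK : IsCompact K := hφc
    have hKp : K ⊆ punctured := hφp.trans exterior_subset_punctured
    have hφ1 : ContDiff ℝ 1 φ := hφs.of_le (by norm_cast)
    have hφcont : Continuous φ := hφs.continuous
    have hDφcont : Continuous (fderiv ℝ φ) := hφ1.continuous_fderiv one_ne_zero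
    have hDφc : HasCompactSupport (fderiv ℝ φ) := hφc.fderiv (𝕜 := ℝ)
    obtain ⟨Mφ, hMφ⟩ := hφcont.bounded_above_of_compact_support hφc
    obtain ⟨MD, hMD⟩ := hDφcont.bounded_above_of_compact_support hDφc
    have hMφ0 : 0 ≤ Mφ := (norm_nonneg _).trans (hMφ 0)
    -- (f1) integration by parts at level `j`
    have hf1 : ∀ j, ∫ y, fderiv ℝ φ y (e k) * ⟪Vj j y, e i⟫ = -∫ y, φ y * F (k, i) j y :=
      fun j => integral_fderiv_mul_inner_eq (hV1 j) hφ1 hφc (e k) (e i)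
    -- (f2) the left-hand sides converge along `σ` (strong `L¹_loc` convergence of `V_j`)
    have hdlim : Tendsto (fun j => ∫⁻ y in K, ‖Vj (σ j) y - V y‖ₑ) atTop (𝓝 0) := by
      have h4 := tendsto_lintegral_V_sub_of_integral hflow.smooth_v.continuous hK hVm
        (hVint K hK hKp) (hconvV K hK hKp)
      have hdm : ∀ j, AEMeasurable (fun y => ‖Vj j y - V y‖ₑ) (volume.restrict K) := fun j =>
        ((hVjm j).sub hVm).enorm.restrict
      exact (tendsto_lintegral_one_of_four hK.measure_lt_top.ne hdm h4).comp hσ.tendsto_atTop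
    have hf2 : Tendsto (fun j => ∫ y, fderiv ℝ φ y (e k) * ⟪Vj (σ j) y, e i⟫) atTop
        (𝓝 (∫ y, fderiv ℝ φ y (e k) * ⟪V y, e i⟫)) := by
      have hmeas : AEStronglyMeasurable (fun y => fderiv ℝ φ y (e k) * ⟪V y, e i⟫) volume :=
        (hDφcont.clm_apply continuous_const).aestronglyMeasurable.mul
          (hVm.inner aestronglyMeasurable_const)
      have hFi : ∀ j, Integrable (fun y => fderiv ℝ φ y (e k) * ⟪Vj (σ j) y, e i⟫) volume := by
        intro j
        refine ((hDφcont.clm_apply continuous_const).mul ((hVc (σ j)).inner continuous_const))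
          |>.integrable_of_hasCompactSupport ?_
        exact (hDφc.mono fun x hx => by
          contrapose! hx
          simp only [Function.mem_support, ne_eq, not_not] at hx ⊢
          simp [hx]).mul_right
      refine tendsto_integral_of_L1 _ hmeas (Eventually.of_forall hFi) ?_
      refine tendsto_lintegral_sub_of_support (K := K)
        (G := fun j y => ENNReal.ofReal MD * ‖Vj (σ j) y - V y‖ₑ) (fun j y hy => ?_)
        (fun j y => ?_) ?_
      · rw [fderiv_of_notMem_tsupport ℝ hy]; simp
      · rw [← real_inner_smul_right, ← real_inner_smul_right]
        refine enorm_inner_sub_inner_le ?_ _ _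
        rw [norm_smul, he1, mul_one]
        exact ((fderiv ℝ φ y).le_opNorm _).trans (by rw [he1, mul_one]; exact hMD y)
      · have h := ENNReal.Tendsto.const_mul (a := ENNReal.ofReal MD) hdlim
          (Or.inr ENNReal.ofReal_ne_top)
        rw [mul_zero] at h
        refine (tendsto_congr fun j => ?_).2 h
        exact lintegral_const_mul'' _ (((hVjm (σ j)).sub hVm).enorm.restrict)
    -- (f3) the right-hand sides converge along `σ` (weak convergence in `L^{9/5}(w dy)`)
    have hcov : K ⊆ ⋃ k, B k := fun y hy => by
      obtain ⟨k', hk'⟩ := hcover y (hφp hy); exact mem_iUnion.2 ⟨k', hk'⟩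
    obtain ⟨t, ht⟩ := hK.elim_finite_subcover B (fun k => isOpen_ball) hcov
    set δ : ℝ≥0∞ := ∏ k' ∈ t, ε k' with hδ_def
    have hδ0 : δ ≠ 0 := Finset.prod_ne_zero_iff.2 fun k' _ => hε0 k'
    have hδtop : δ ≠ ∞ := ENNReal.prod_ne_top fun k' _ => hεtop k'
    have hδle : ∀ k' ∈ t, δ ≤ ε k' := fun k' hk' => by
      rw [hδ_def, ← Finset.mul_prod_erase t ε hk']
      calc ε k' * ∏ x ∈ t.erase k', ε x ≤ ε k' * 1 := by
            gcongr; exact Finset.prod_le_one' fun x _ => hε1 x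
        _ = ε k' := mul_one _
    have hδw : ∀ y ∈ K, δ ≤ w y := fun y hy => by
      obtain ⟨k', hk't, hyk'⟩ : ∃ k' ∈ t, y ∈ B k' := by simpa using ht hy
      exact (hδle k' hk't).trans (hεw k' y hyk')
    have hδr : 0 < δ.toReal := ENNReal.toReal_pos hδ0 hδtop
    -- the test function `ψ = φ / w`
    set ψ : E3 → ℝ := fun y => (w y).toReal⁻¹ * φ y with hψ_def
    have hψm : Measurable ψ := (hwm.ennreal_toReal.inv).mul hφcont.measurable
    have hψbd : ∀ y, ‖ψ y‖ ≤ δ.toReal⁻¹ * Mφ := by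
      intro y
      show ‖(w y).toReal⁻¹ * φ y‖ ≤ δ.toReal⁻¹ * Mφ
      by_cases hy : y ∈ K
      · have hwy : δ.toReal ≤ (w y).toReal := ENNReal.toReal_mono (hwlt y).ne (hδw y hy)
        have hwpos : 0 < (w y).toReal := hδr.trans_le hwy
        rw [norm_mul, norm_inv, Real.norm_of_nonneg hwpos.le]
        exact mul_le_mul (inv_anti₀ hδr hwy) (hMφ y) (norm_nonneg _) (by positivity)
      · have : φ y = 0 := image_eq_zero_of_notMem_tsupport hy
        rw [this, mul_zero, norm_zero]; positivity
    have hψmem : MemLp ψ (ENNReal.ofReal (9 / 4)) μ :=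
      (memLp_top_of_bound hψm.aestronglyMeasurable _ (Eventually.of_forall hψbd)).mono_exponent
        le_top
    have hweak := hgw (k, i) ψ hψmem
    -- `μ`-integrals against `ψ` are `volume`-integrals against `φ`
    have hconv_int : ∀ H : E3 → ℝ, ∫ x, H x * ψ x ∂μ = ∫ y, φ y * H y := by
      intro H
      rw [hμ_def, integral_withDensity_eq_integral_toReal_smul₀ hwm.aemeasurable
        (Eventually.of_forall hwlt)]
      refine integral_congr_ae (Eventually.of_forall fun y => ?_)
      simp only [hψ_def, smul_eq_mul]
      by_cases hwy : (w y).toReal = 0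
      · -- then `w y = 0`, so `y` lies in no ball, hence outside the exterior region: `φ y = 0`
        have hw0 : w y = 0 := by
          rcases (ENNReal.toReal_eq_zero_iff _).1 hwy with h | h
          · exact h
          · exact absurd h (hwlt y).ne
        have hyK : y ∉ K := by
          intro hyK
          have := hδw y hyK
          rw [hw0] at this
          exact hδ0 (le_antisymm this bot_le)
        rw [image_eq_zero_of_notMem_tsupport hyK, hwy]; ring
      · field_simp
    rw [hconv_int] at hweak
    simp only [hconv_int] at hweak
    -- replace `g` by its exterior cut-off in the limit
    have hgg : ∫ y, φ y * g (k, i) y = ∫ y, φ y * gout (k, i) y := by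
      refine integral_congr_ae (Eventually.of_forall fun y => ?_)
      by_cases hy : y ∈ U
      · simp only [hgout_def, indicator_of_mem hy]
      · have hyK : y ∉ K := fun h => hy (hUext ▸ hφp h)
        simp only [image_eq_zero_of_notMem_tsupport hyK, zero_mul]
    -- conclusion
    have hlim' : Tendsto (fun j => ∫ y, fderiv ℝ φ y (e k) * ⟪Vj (σ j) y, e i⟫) atTop
        (𝓝 (-∫ y, φ y * gout (k, i) y)) := by
      rw [← hgg]
      simp only [hf1]
      exact hweak.neg
    exact tendsto_nhds_unique hf2 hlim'

end Summit.NavierStokesRegularity.NavierStokesRegularity.Theorems.Wu2026Salvage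

end

-- WHAT THIS IS NOT: not a claim about NS regularity or blow-up; not a claim about any author beyond the typed locator.
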